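import Mathlib
import Summits.Ventures.HodgeRepro2.T5LocalNormIndex
import Summits.Ventures.HodgeRepro2.T5RamifiedCharacterCount
import Summits.Ventures.HodgeRepro2.T5RamifiedOddConductor
import Summits.Ventures.HodgeRepro2.T6N5TateTwist
import Summits.Ventures.HodgeRepro2.T6N5Hyp
import Summits.Ventures.HodgeRepro2.T6N5LocalDatum
import Summits.Ventures.HodgeRepro2.T6N5LocalCharDatum
import Summits.Ventures.HodgeRepro2.T6N5LocalRamHyp
import Summits.Ventures.HodgeRepro2.T6N5LocalRam
import Summits.Ventures.HodgeRepro2.T6N5LocalInertCompletion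
import Summits.Ventures.HodgeRepro2.T6N5LocalRamCompletion
import Summits.Ventures.HodgeRepro2.T6N5LocalRamOnCompletion
import Summits.Ventures.HodgeRepro2.T6N5LocalTateChars
import Summits.Ventures.HodgeRepro2.T6N5LocalRamTateSide
import Summits.Ventures.HodgeRepro2.T6N5LocalRamToyEps

/-!
# T6N5LocalRamToyEpsDisplays — Tier 6, M2 sub-step N5 (t6-p8's half): the two printed displays hold for the toy
ε-factor of `T6N5LocalRamToyEps`, and conjugate-symplectic characters of both signs exist

For the toy ramified datum `Dt ψδ` of `T6N5LocalRamToyEps` (Mathlib's completions at a ramified place):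
* `hT6_toy`: Tate's (3.2.6.3) holds — `m`, `X` and `c` are invariant under unramified twists and `χ(π)^m` picks up
  `ω(π^m)` (`epsToy_mul_of_unramified`);
* `hG_toy`: GGP Prop. 5.1 (2) holds — `ε(½, ξ, ψ) = X(ξ)^{−m/2}·ξ(π)^m` (`epsToy_half`) and
  `X(ξ) = ξ(u)·c(ξ) = ξ(u)·ξ(ϖ) = ξ(π)²` for conjugate-dual `ξ` (`cF_eq_of_conjDual`, `Xc_eq_sq_of_conjDual`: `η_v`
  is ramified at a ramified place), so the square is `1` (`sq_eq_one_aux`);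
* the datum conditions `hμ`, `hodd`, `heven` on the toy datum, and `exists_isCS_eps_eq_toy` /
  `exists_isCO_eps_inv_χW_mul_eq`: conjugate-symplectic smooth characters of BOTH signs `ε_v = ±1` (Lemma N5.L4's
  `μ`-twist from the displays, `T6N5LocalRam.exists_isCS_eps_eq`) — hence conjugate-orthogonal smooth `α` with
  `ε_v(χ_W⁻¹ α) = ±1`, the non-vacuity input of the quotient Weil toy.
README §8(d): uses an L-value-free non-vanishing device: NO.
-/

namespace Summit.Ventures.HodgeRepro2.T6.N5LocalRamToyEps

open Summit.Ventures.HodgeRepro2 IsDedekindDomain HeightOneSpectrum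
  Summit.Ventures.HodgeRepro2.T6.N5LocalDatum Summit.Ventures.HodgeRepro2.T6.N5LocalCharDatum
  Summit.Ventures.HodgeRepro2.T6.N5LocalRamDatum Summit.Ventures.HodgeRepro2.T6.N5Local
  Summit.Ventures.HodgeRepro2.T6.N5LocalRam Summit.Ventures.HodgeRepro2.T6.Hyp
  Summit.Ventures.HodgeRepro2.T6.N5LocalInertCompletion Summit.Ventures.HodgeRepro2.T6.N5LocalRamCompletion
  Summit.Ventures.HodgeRepro2.T6.N5LocalRamOnCompletion Summit.Ventures.HodgeRepro2.T6.N5LocalTateChars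
  Summit.Ventures.HodgeRepro2.T6.N5LocalRamTateSide Summit.Ventures.HodgeRepro2.T5ConductorArithmetic

-- `K`, `L` in `Type` (universe `0`).
variable {K : Type} [Field K] [NumberField K] {v : HeightOneSpectrum (NumberField.RingOfIntegers K)}
  {L : Type} [Field L] [NumberField L] [Algebra K L] {w : HeightOneSpectrum (NumberField.RingOfIntegers L)}
  [w.asIdeal.LiesOver v.asIdeal]
  [ContinuousSMul (v.adicCompletion K) (w.adicCompletion L)]
  [IsScalarTower K (v.adicCompletion K) (w.adicCompletion L)]

noncomputable section

namespace RamPlace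

variable (Q : RamPlace v w)

/-! ### The two printed displays hold for the toy ε-factor -/

omit [ContinuousSMul (v.adicCompletion K) (w.adicCompletion L)]
  [IsScalarTower K (v.adicCompletion K) (w.adicCompletion L)] in
/-- `ω(π^m) = ω(π)^m` as complex numbers. -/
theorem coe_map_zpow (ω : (w.adicCompletion L)ˣ →* ℂˣ) (m : ℤ) :
    ((ω (Q.πU ^ m) : ℂˣ) : ℂ) = ((ω Q.πU : ℂˣ) : ℂ) ^ m := by
  rw [map_zpow, Units.val_zpow_eq_zpow_val]

/-- The unramified-twist identity for the toy ε-factor, on the plain carriers. -/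
theorem epsToy_mul_of_unramified (ψδ : PsiC w) (χ ω : (w.adicCompletion L)ˣ →* ℂˣ)
    (hχ : ∃ n, Uπ w Q.π n ≤ χ.ker) (hω : Uπ w Q.π 0 ≤ ω.ker) (ψ : PsiC w) (dx : ℝ) :
    Q.epsToy (χ * ω) ψ dx = Q.epsToy χ ψ dx * ((ω (Q.πU ^ (Q.mm χ ψ)) : ℂˣ) : ℂ) := by
  have hm : Q.mm (χ * ω) ψ = Q.mm χ ψ := Q.mm_mul_of_unramified ψδ χ ω hχ hω ψ
  have hX : Q.Xc (χ * ω) = Q.Xc χ := Q.Xc_mul_of_unramified χ ω hω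
  have hπ' : (((χ * ω) Q.πU : ℂˣ) : ℂ) = ((χ Q.πU : ℂˣ) : ℂ) * ((ω Q.πU : ℂˣ) : ℂ) := by
    rw [MonoidHom.mul_apply, Units.val_mul]
  rw [Q.coe_map_zpow ω]
  unfold epsToy
  rw [hm, hX, hπ', mul_zpow]
  ring

/-- TATE'S (3.2.6.3) HOLDS FOR THE TOY ε-FACTOR: for smooth `χ` and unramified `ω`,
`ε(χω, ψ, dx) = ε(χ, ψ, dx) · ω(π^{n(ψ) + a(χ)})`. -/
theorem hT6_toy (ψδ : PsiC w) : Tate1979_3_2_6_3 (Q.Dt ψδ) := by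
  intro χ ω ψ dx hχ hω
  exact Q.epsToy_mul_of_unramified ψδ χ ω hχ hω ψ dx

/-- `ε(½, ξ, ψ) = X(ξ)^{−m/2} · ξ(π)^m` for smooth `ξ`, on the plain carriers. -/
theorem epsToy_half (ψδ : PsiC w) (ξ : (w.adicCompletion L)ˣ →* ℂˣ) (hs : ∃ n, Uπ w Q.π n ≤ ξ.ker)
    (ψ : PsiC w) :
    Q.epsToy (ξ * omega w (1 / 2)) ψ (sd w ψ) =
      Q.Xc ξ ^ (-(Q.mm ξ ψ : ℂ) / 2) * ((ξ Q.πU : ℂˣ) : ℂ) ^ (Q.mm ξ ψ) := by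
  have hω' : Uπ w Q.π 0 ≤ (omega w (1 / 2)).ker := omega_half_unramified w Q.π
  have hm : Q.mm (ξ * omega w (1 / 2)) ψ = Q.mm ξ ψ := Q.mm_mul_of_unramified ψδ ξ _ hs hω' ψ
  have hX : Q.Xc (ξ * omega w (1 / 2)) = Q.Xc ξ := Q.Xc_mul_of_unramified ξ _ hω'
  have hπ' : (((ξ * omega w (1 / 2)) Q.πU : ℂˣ) : ℂ) = ((ξ Q.πU : ℂˣ) : ℂ) * Q.nh := by
    rw [MonoidHom.mul_apply, Units.val_mul, omega_apply]
    rfl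
  have hsd : ((sd w ψ / sd w ψ : ℝ) : ℂ) = 1 := by
    have hpos : 0 < sd w ψ := Real.sqrt_pos.mpr (zpow_pos (by exact_mod_cast qE_pos w) _)
    rw [div_self hpos.ne', Complex.ofReal_one]
  unfold epsToy
  rw [hm, hX, hπ', hsd, mul_zpow, one_mul]
  have hnh : Q.nh ^ (-(Q.mm ξ ψ)) * Q.nh ^ (Q.mm ξ ψ) = 1 := by
    rw [zpow_neg, inv_mul_cancel₀ (zpow_ne_zero _ Q.nh_ne_zero)]
  calc Q.nh ^ (-(Q.mm ξ ψ)) * Q.Xc ξ ^ (-(Q.mm ξ ψ : ℂ) / 2) * (((ξ Q.πU : ℂˣ) : ℂ) ^ (Q.mm ξ ψ) *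
        Q.nh ^ (Q.mm ξ ψ))
      = (Q.nh ^ (-(Q.mm ξ ψ)) * Q.nh ^ (Q.mm ξ ψ)) *
        (Q.Xc ξ ^ (-(Q.mm ξ ψ : ℂ) / 2) * ((ξ Q.πU : ℂˣ) : ℂ) ^ (Q.mm ξ ψ)) := by ring
    _ = _ := by rw [hnh, one_mul]

/-- `c(ξ) = ξ(ϖ)` for conjugate-dual `ξ` (conjugate-symplectic or conjugate-orthogonal) — `η_v` is ramified. -/
theorem cF_eq_of_conjDual (ψδ : PsiC w) (ξ : (w.adicCompletion L)ˣ →* ℂˣ)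
    (hξ : (Q.Dt ψδ).toLocalSignDatum.IsCS ξ ∨ (Q.Dt ψδ).toLocalSignDatum.IsCO ξ) :
    Q.cF ξ = ((ξ Q.ϖU : ℂˣ) : ℂ) := by
  classical
  unfold cF
  rcases hξ with hCS | hCO
  · have hCS' : ∀ x : Fsub v w, ξ x = ηF v w Q.σ Q.hind x :=
      fun x => (CharDatum.isCS_iff (Q.Dt ψδ).toCharDatum ξ).mp hCS ⟨x.1, x.2⟩
    obtain ⟨f, hf0, hf1⟩ := Q.exists_mem_Fsub_inf_ηF_eq_neg_one
    have hne : ¬ ∀ x ∈ Fsub v w ⊓ Uπ w Q.π 0, ξ x = 1 := by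
      intro h
      have h1 := h f ⟨f.2, hf0⟩
      rw [hCS' f, hf1] at h1
      have h2 : ((-1 : ℂˣ) : ℂ) = ((1 : ℂˣ) : ℂ) := by rw [h1]
      norm_num at h2
    rw [if_neg hne, hCS' ⟨Q.ϖU, Q.ϖU_mem_Fsub⟩]
  · have hCO' : ∀ x : Fsub v w, ξ x = 1 :=
      fun x => (CharDatum.isCO_iff (Q.Dt ψδ).toCharDatum ξ).mp hCO ⟨x.1, x.2⟩
    have hpos : ∀ x ∈ Fsub v w ⊓ Uπ w Q.π 0, ξ x = 1 := fun x hx => hCO' ⟨x, hx.1⟩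
    rw [if_pos hpos, hCO' ⟨Q.ϖU, Q.ϖU_mem_Fsub⟩]
    rfl

/-- `X(ξ) = ξ(u)·ξ(ϖ) = ξ(π)²` for conjugate-dual `ξ`. -/
theorem Xc_eq_sq_of_conjDual (ψδ : PsiC w) (ξ : (w.adicCompletion L)ˣ →* ℂˣ)
    (hξ : (Q.Dt ψδ).toLocalSignDatum.IsCS ξ ∨ (Q.Dt ψδ).toLocalSignDatum.IsCO ξ) :
    Q.Xc ξ = ((ξ Q.πU : ℂˣ) : ℂ) ^ (2 : ℤ) := by
  unfold Xc
  rw [Q.cF_eq_of_conjDual ψδ ξ hξ, ← Units.val_mul, ← map_mul, ← Q.πU_sq, map_pow, Units.val_pow_eq_pow_val,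
    zpow_ofNat]

/-- The square of `X^{−m/2} · z^m` is `1` when `X = z²` (`z ≠ 0`). -/
theorem sq_eq_one_aux (z : ℂ) (hz : z ≠ 0) (m : ℤ) :
    ((z ^ (2 : ℤ)) ^ (-(m : ℂ) / 2) * z ^ m) ^ 2 = 1 := by
  have h1 : ((z ^ (2 : ℤ)) ^ (-(m : ℂ) / 2)) ^ 2 = (z ^ (2 : ℤ)) ^ (-m) := by
    have he : ((2 : ℕ) : ℂ) * (-(m : ℂ) / 2) = ((-m : ℤ) : ℂ) := by
      push_cast
      ring
    rw [← Complex.cpow_nat_mul, he, Complex.cpow_intCast]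
  have h2 : (z ^ m) ^ 2 = (z ^ (2 : ℤ)) ^ m := by
    rw [← zpow_natCast, ← zpow_mul, ← zpow_mul]
    congr 1
    ring
  rw [mul_pow, h1, h2, zpow_neg, inv_mul_cancel₀ (zpow_ne_zero _ (zpow_ne_zero _ hz))]

/-- GGP'S PROPOSITION 5.1 (2) HOLDS FOR THE TOY ε-FACTOR: `ε(½, ξ, ψ)² = 1` for conjugate-dual smooth `ξ` (and
every `ψ`). -/
theorem hG_toy (ψδ : PsiC w) : GGP2012_Prop5_1_2 (Q.Dt ψδ) := by
  intro ψ _ ξ hξ hs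
  change (w.adicCompletion L)ˣ →* ℂˣ at ξ
  have hs' : ∃ n, Uπ w Q.π n ≤ ξ.ker := hs
  have h := Q.epsToy_half ψδ ξ hs' ψ
  rw [Q.Xc_eq_sq_of_conjDual ψδ ξ hξ] at h
  show (Q.epsToy (ξ * omega w (1 / 2)) ψ (sd w ψ)) ^ 2 = 1
  rw [h]
  exact sq_eq_one_aux _ (Units.ne_zero _) _

/-! ### Conjugate-symplectic smooth characters of both signs on the toy datum -/

omit [ContinuousSMul (v.adicCompletion K) (w.adicCompletion L)] in
/-- `μ` is unramified on the toy datum. -/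
theorem μ_unramified_toy (ψδ : PsiC w) : (Q.Dt ψδ).IsUnramified (μ w) := μ_mem_Uπ_zero w Q.π

omit [ContinuousSMul (v.adicCompletion K) (w.adicCompletion L)] in
/-- `hμ` of the toy datum: `μ` conjugate-orthogonal, unramified, `μ(π) = −1`. -/
theorem hμ_toy (ψδ : PsiC w) :
    ∃ μ' : (w.adicCompletion L)ˣ →* ℂˣ, (Q.Dt ψδ).toLocalSignDatum.IsCO μ' ∧ (Q.Dt ψδ).IsUnramified μ' ∧
      ((μ' (Q.Dt ψδ).π : ℂˣ) : ℂ) = -1 := by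
  refine ⟨μ w, ?_, μ_mem_Uπ_zero w Q.π, ?_⟩
  · rw [CharDatum.isCO_iff]
    intro x
    exact μ_isCO v w Q.h2 Q.hϖ Q.hπ Q.hram x.1 x.2
  · show ((μ w Q.πU : ℂˣ) : ℂ) = -1
    rw [μ_uniformizer w Q.hπ]
    rfl

omit [ContinuousSMul (v.adicCompletion K) (w.adicCompletion L)] in
/-- `hodd` of the toy datum: the chosen `χ_W` is conjugate-symplectic, smooth, of odd conductor. -/
theorem hodd_toy (ψδ : PsiC w) :
    ∃ ωt : (w.adicCompletion L)ˣ →* ℂˣ, (Q.Dt ψδ).toLocalSignDatum.IsCS ωt ∧ (Q.Dt ψδ).IsSmooth ωt ∧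
      Odd ((Q.Dt ψδ).cond ωt) := by
  obtain ⟨hF, hs, hodd⟩ := Q.χWt_spec
  refine ⟨Q.χWt, ?_, hs, hodd⟩
  rw [CharDatum.isCS_iff]
  intro x
  exact hF x

omit [ContinuousSMul (v.adicCompletion K) (w.adicCompletion L)] in
/-- `heven` of the toy datum: conjugate-orthogonal smooth characters of even conductor above any bound. -/
theorem heven_toy (ψδ : PsiC w) (k : ℕ) :
    ∃ β : (w.adicCompletion L)ˣ →* ℂˣ, (Q.Dt ψδ).toLocalSignDatum.IsCO β ∧ (Q.Dt ψδ).IsSmooth β ∧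
      Even ((Q.Dt ψδ).cond β) ∧ k < (Q.Dt ψδ).cond β := by
  obtain ⟨β, hβF, hβs, hβc⟩ := exists_CO_exact_even_level v w Q.h2 Q.hϖ Q.hπ Q.hram k
  refine ⟨β, ?_, hβs, ?_, ?_⟩
  · rw [CharDatum.isCO_iff]
    intro x
    exact hβF x.1 x.2
  · show Even (conductor (Uπ w Q.π) β)
    rw [hβc]
    exact ⟨k + 1, by ring⟩
  · show k < conductor (Uπ w Q.π) β
    rw [hβc]
    omega

/-- BOTH SIGNS OCCUR on the toy datum: for each `s = ±1` a conjugate-symplectic smooth `χ` with `ε_v(χ) = s`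
(`T6N5LocalRam.exists_isCS_eps_eq` from the two displays). -/
theorem exists_isCS_eps_eq_toy (ψδ : PsiC w)
    (hK : ∀ a : v.adicCompletion K, ψδ.1 (algebraMap (v.adicCompletion K) (w.adicCompletion L) a) = 1)
    (s : ℤˣ) :
    ∃ χ : (w.adicCompletion L)ˣ →* ℂˣ, (Q.Dt ψδ).toLocalSignDatum.IsCS χ ∧ (Q.Dt ψδ).IsSmooth χ ∧
      (Q.Dt ψδ).eps χ = s := by
  obtain ⟨χ, hCS, hs, -, heps⟩ := exists_isCS_eps_eq (Q.Dt ψδ) (Q.hT6_toy ψδ) (Q.hG_toy ψδ) (Uπ_antitone w Q.π)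
    (omega_half_unramified w Q.π) (isConjInvC_of_trivial_on_base v w Q.h2 Q.σ Q.hσ ψδ hK) (Q.hμ_toy ψδ)
    (exists_isCS_odd (Q.Dt ψδ) (Uπ_antitone w Q.π) (Q.hodd_toy ψδ) (Q.heven_toy ψδ)) s
  exact ⟨χ, hCS, hs, heps⟩

/-- BOTH SIGNS on conjugate-orthogonal smooth `α` through `χ_W⁻¹·α`: for each `s` a conjugate-orthogonal smooth
`α` with `ε_v(χ_W⁻¹ α) = s` (the non-vacuity input `hboth` of the quotient Weil toy). -/
theorem exists_isCO_eps_inv_χW_mul_eq (ψδ : PsiC w)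
    (hK : ∀ a : v.adicCompletion K, ψδ.1 (algebraMap (v.adicCompletion K) (w.adicCompletion L) a) = 1)
    (s : ℤˣ) :
    ∃ α : (Q.Dt ψδ).E →* ℂˣ, (Q.Dt ψδ).toLocalSignDatum.IsCO α ∧ (Q.Dt ψδ).IsSmooth α ∧
      (Q.Dt ψδ).eps ((Q.Dt ψδ).χW⁻¹ * α) = s := by
  obtain ⟨χ, hCS, hs, heps⟩ := Q.exists_isCS_eps_eq_toy ψδ hK s
  change (w.adicCompletion L)ˣ →* ℂˣ at χ
  obtain ⟨hF, hWs, -⟩ := Q.χWt_spec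
  have hCS' : ∀ x : Fsub v w, χ x = ηF v w Q.σ Q.hind x :=
    fun x => (CharDatum.isCS_iff (Q.Dt ψδ).toCharDatum χ).mp hCS ⟨x.1, x.2⟩
  let α : (w.adicCompletion L)ˣ →* ℂˣ := MonoidHom.mk' (fun x => Q.χWt x * χ x)
    (fun x y => by rw [map_mul, map_mul]; exact mul_mul_mul_comm _ _ _ _)
  have hα' : ∀ x, α x = Q.χWt x * χ x := fun x => rfl
  have hCO : ∀ x : Fsub v w, α x = 1 := by
    intro x
    rw [hα', hF x, hCS' x]
    have h := congrArg (fun φ : Fsub v w →* ℂˣ => φ x) (N5LocalRamOnCompletion.ηF_mul_self v w Q.σ Q.hind)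
    simpa using h
  have hsm : ∃ n, Uπ w Q.π n ≤ α.ker := by
    obtain ⟨n₁, hn₁⟩ := hWs
    obtain ⟨n₂, hn₂⟩ := hs
    have hn₂' : Uπ w Q.π n₂ ≤ χ.ker := hn₂
    refine ⟨max n₁ n₂, fun x hx => ?_⟩
    rw [MonoidHom.mem_ker, hα', MonoidHom.mem_ker.mp (hn₁ (Uπ_antitone w Q.π (le_max_left n₁ n₂) hx)),
      MonoidHom.mem_ker.mp (hn₂' (Uπ_antitone w Q.π (le_max_right n₁ n₂) hx)), mul_one]
  have hmul : Q.χWt⁻¹ * α = χ := by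
    refine MonoidHom.ext fun x => ?_
    rw [MonoidHom.mul_apply, MonoidHom.inv_apply, hα', inv_mul_cancel_left]
  refine ⟨α, (CharDatum.isCO_iff (Q.Dt ψδ).toCharDatum _).mpr fun x => hCO ⟨x.1, x.2⟩, hsm, ?_⟩
  show (Q.Dt ψδ).eps (Q.χWt⁻¹ * α) = s
  rw [hmul]
  exact heps

end RamPlace



end

end Summit.Ventures.HodgeRepro2.T6.N5LocalRamToyEps
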